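/-
Copyright (c) 2026. All rights reserved.
Released under Apache 2.0 license as described in the file LICENSE.
Authors: abc-iut cell, wave-2 seat abc-iut-L3-t11 (proof-only; G10 rung 3b: the estrangement step (2) of the
printed proof of [SemiAnbd] Thm 3.7 (iii), assembled modulo the finite-level data and Rmk 2.2.1).
-/
import Literature.AnabelianGeometry.SemiGraphs.TreeFixedBranchPairProofs
import Literature.AnabelianGeometry.SemiGraphs.TreeSystemFixedPoint
import HarnessLib

/-!
# Step (2) of the proof of [SemiAnbd] Thm 3.7 (iii): eventually at most two fixed vertices

Mochizuki, *Semi-graphs of anabelioids*, Publ. RIMS **42** (2006) [MochizukiSemiAnbd2006], proof of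
Thm 3.7 (iii), p. 41 (PRIMS p. 266): "suppose that for some cofinal subset `J ⊆ I`, `H` fixes `≥ 3`
vertices of `G_{∞,j}`, for every `j ∈ J`. Then by Lemma 1.8, (ii), (c) … `H` acts trivially on some
subjoint of `G_{∞,j}`. In particular, `H` acts trivially on some subjoint of `G_j`. Since the semi-graphs
`G_j` are all finite, we thus conclude that we may choose a compatible system of such subjoints … But this
implies [cf. Remark 2.2.1] that `H` is contained in … the intersection of the images of `π₁(G_e)`,
`π₁(G_{e'})`, via `b`, `b'`. But since `G` is assumed to be totally estranged, we thus conclude that `H` is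
trivial … Thus … for some cofinal subset … `H` fixes at least one, but no more than two vertices".

This PROOF-ONLY file assembles exactly this step for a subgroup `C` of a group `P` acting on a directed
system of TREES `T j` (the `G_{∞,j}`) lying, via equivariant IMMERSIONS `q j`, over FINITE semi-graphs
`G j` (the `G_j`) with equivariant immersive transition morphisms — modulo ONE hypothesis `hnobp` carrying
the anabelioid content (Rmk 2.2.1 + total estrangement): "if `C` fixes a compatible system of BRANCH-PAIRS
(a vertex with two distinct abutting branches) of the finite levels, then `C = 1`". Conclusion
(`atMostTwo_eventually_of_levelData`): if `C ≠ 1`, then from some level on any three `C`-fixed vertices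
of `T j` have two equal — the hypothesis `htwo` of `TreeSystemFixedPair` /
`TemperedCompactInVerticialConj2Skeleton`. Tools: `exists_fixed_branchPair_map_of_three_fixed`,
`fixed_branchPair_map` (`TreeFixedBranchPairProofs`) and abc-iut-L3-t6's
`exists_compatible_of_finite` (Kőnig for inverse systems of finite sets). No definitions.
-/

namespace Literature.AnabelianGeometry.SemiGraphs

namespace SemiGraph

open CategoryTheory

universe v u

/-- **Step (2) of the proof of Thm 3.7 (iii), modulo the finite-level data**: `C ≤ P` acts on trees
`T j` over finite semi-graphs `G j` (equivariant immersions `q j`, equivariant immersive functorial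
transitions `gf`); if no nontrivial... precisely: if "`C` fixes a compatible system of branch-pairs of the
`G j`" forces `C = ⊥` (`hnobp`), and `C ≠ ⊥`, then eventually any three `C`-fixed vertices of `T j` have
two equal. [cite: MochizukiSemiAnbd2006, Thm. 3.7(iii) p.41] -/
theorem atMostTwo_eventually_of_levelData {P : Type u} [Group P] (C : Subgroup P)
    {J : Type v} [Preorder J] [IsDirectedOrder J] [Nonempty J]
    (T : J → SemiGraph.{u}) (hT : ∀ j, (T j).IsTree) (ρ : ∀ j, P →* Aut (T j))
    (G : J → SemiGraph.{u}) [∀ j, Finite (G j).Vertex] [∀ j, Finite (G j).Branch]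
    (τ : ∀ j, P →* Aut (G j)) (q : ∀ j, T j ⟶ G j) (hq : ∀ j, IsImmersion (q j))
    (hqe : ∀ (j : J) (g : P), (ρ j g).hom ≫ q j = q j ≫ (τ j g).hom)
    (gf : ∀ ⦃i j : J⦄, i ≤ j → (G j ⟶ G i)) (hgf : ∀ ⦃i j : J⦄ (h : i ≤ j), IsImmersion (gf h))
    (gf_id : ∀ j, gf (le_refl j) = 𝟙 (G j))
    (gf_comp : ∀ ⦃i j k : J⦄ (hij : i ≤ j) (hjk : j ≤ k), gf hjk ≫ gf hij = gf (hij.trans hjk))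
    (hgfe : ∀ ⦃i j : J⦄ (h : i ≤ j) (g : P), (τ j g).hom ≫ gf h = gf h ≫ (τ i g).hom)
    (hnobp : ∀ (w : ∀ j, (G j).Vertex) (β β' : ∀ j, (G j).Branch),
      (∀ j, β j ≠ β' j ∧ (G j).abuts (β j) = some (w j) ∧ (G j).abuts (β' j) = some (w j)) →
      (∀ ⦃i j : J⦄ (h : i ≤ j), (gf h).vertexMap (w j) = w i ∧ (gf h).branchMap (β j) = β i ∧
        (gf h).branchMap (β' j) = β' i) →
      (∀ (j : J) (γ : C), (τ j γ).hom.vertexMap (w j) = w j ∧ (τ j γ).hom.branchMap (β j) = β j ∧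
        (τ j γ).hom.branchMap (β' j) = β' j) → C = ⊥)
    (hC : C ≠ ⊥) :
    ∃ j₀ : J, ∀ j, j₀ ≤ j → ∀ a b d : (T j).Vertex,
      (∀ γ : C, (ρ j γ).hom.vertexMap a = a) → (∀ γ : C, (ρ j γ).hom.vertexMap b = b) →
      (∀ γ : C, (ρ j γ).hom.vertexMap d = d) → a = b ∨ b = d ∨ a = d := by
  classical
  -- restricted actions
  let ρC : ∀ j, C →* Aut (T j) := fun j => (ρ j).comp C.subtype
  let τC : ∀ j, C →* Aut (G j) := fun j => (τ j).comp C.subtype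
  have hqeC : ∀ (j : J) (γ : C), (ρC j γ).hom ≫ q j = q j ≫ (τC j γ).hom := fun j γ => hqe j γ
  have hgfeC : ∀ ⦃i j : J⦄ (h : i ≤ j) (γ : C), (τC j γ).hom ≫ gf h = gf h ≫ (τC i γ).hom :=
    fun i j h γ => hgfe h γ
  by_contra hno
  push Not at hno
  -- the finite sets of `C`-fixed branch-pairs of the finite levels
  let X : J → Type u := fun j => (G j).Vertex × (G j).Branch × (G j).Branch
  let F : ∀ j, Set (X j) := fun j => {t | t.2.1 ≠ t.2.2 ∧ (G j).abuts t.2.1 = some t.1 ∧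
    (G j).abuts t.2.2 = some t.1 ∧ ∀ γ : C, (τC j γ).hom.vertexMap t.1 = t.1 ∧
      (τC j γ).hom.branchMap t.2.1 = t.2.1 ∧ (τC j γ).hom.branchMap t.2.2 = t.2.2}
  let f : ∀ ⦃i j : J⦄, i ≤ j → X j → X i :=
    fun i j h t => ((gf h).vertexMap t.1, (gf h).branchMap t.2.1, (gf h).branchMap t.2.2)
  have f_id : ∀ (i : J) (x : X i), f le_rfl x = x := by
    intro i x
    simp only [f, gf_id]
    rfl
  have f_comp : ∀ ⦃i j k : J⦄ (hij : i ≤ j) (hjk : j ≤ k) (x : X k),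
      f hij (f hjk x) = f (hij.trans hjk) x := by
    intro i j k hij hjk x
    simp only [f, ← gf_comp hij hjk, comp_vertexMap, comp_branchMap, Function.comp_apply]
  -- transition maps preserve fixed branch-pairs (descent along the immersions `gf`)
  have hmap : ∀ ⦃i j : J⦄ (h : i ≤ j) (x : X j), x ∈ F j → f h x ∈ F i := by
    rintro i j h ⟨w, b, b'⟩ ⟨hbb, hb, hb', hfix⟩
    obtain ⟨hne', hd₁, hd₂, hfix'⟩ := fixed_branchPair_map (τC j) (τC i) (gf h) (hgf h) (hgfeC h) hbb hb hb' hfix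
    exact ⟨hne', hd₁, hd₂, hfix'⟩
  -- every level carries a fixed branch-pair: three fixed tree vertices above it, descended twice
  have hne : ∀ j, (F j).Nonempty := by
    intro j
    obtain ⟨j', hjj', a, b, d, ha, hb, hd, hab, hbd, had⟩ := hno j
    obtain ⟨w, d₁, d₂, hdd, hw₁, hw₂, hfix⟩ :=
      exists_fixed_branchPair_map_of_three_fixed (ρC j') (τC j') (q j') (hq j') (hqeC j') (hT j')
        hab hbd had ha hb hd
    exact ⟨f hjj' (w, d₁, d₂), hmap hjj' _ ⟨hdd, hw₁, hw₂, hfix⟩⟩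
  have hfin : ∀ j, (F j).Finite := fun j => Set.toFinite _
  obtain ⟨x, hxF, hxc⟩ := exists_compatible_of_finite f f_id f_comp F hfin hne hmap
  -- the compatible system of fixed branch-pairs forces `C = ⊥`
  refine hC (hnobp (fun j => (x j).1) (fun j => (x j).2.1) (fun j => (x j).2.2)
    (fun j => ⟨(hxF j).1, (hxF j).2.1, (hxF j).2.2.1⟩) (fun i j h => ?_) (fun j γ => (hxF j).2.2.2 γ))
  have := hxc h
  exact ⟨congrArg Prod.fst this, congrArg (fun t => t.2.1) this, congrArg (fun t => t.2.2) this⟩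

end SemiGraph

end Literature.AnabelianGeometry.SemiGraphs
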